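import Mathlib
import Summits.PneNP.PneNP.Theorems.SfmBlSignHoeffding
import Summits.PneNP.PneNP.Theorems.SfmBlLegModel

/-!
# The spot budget: first-moment accounting of the bad pairs of a spot — line «sfm-bl»
(PROOF-SFM-BL Lemma 10 and the `B_S(T)` bookkeeping between Prop. 9 and §6)

FRONTIER F-N1c; nothing here bears on P vs NP.

DEFINITION-FREE FORM (same leg model as `SfmBlLegModel` / `SfmBlSpotAccounting`): legs `e : E` of a spot
with `src e : α`, `dst e : β`, output `out e : Fin m`; for a signing `T : Fin m → Bool` the signed
biadjacency `M T` is given by the hypothesis `M T i k = Σ_{e : i → k} χ(T (out e))`.  The family of BAD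
pairs under `T` is supplied by the consumer as a `Finset` `bad T` of pairs `(W₁, W₂)` together with the
membership facts it needs (`hbad…`); `ê(T) := Σ_{W ∈ bad T} #{legs meeting W₁ ∪ W₂}`.

* `good_of_disjoint_bad` — if `bad T` contains every `G`-connected pair with discrepancy
  `> γ√(|W₁||W₂|)`, then every `G`-connected pair disjoint from `B := (⋃ W₁, ⋃ W₂)` over `bad T` is good:
  this is the hypothesis `hgood` of `SfmBl.spot_cut_le` (Prop. 9) for `B = B_S(T)`.
* `card_meeting_bad_le_hatE` — `e_B(T) ≤ ê(T)` (union bound on legs).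
* `card_badSignings_pair_le` — for ONE pair: `#{T : γ√(|W₁||W₂|) < |disc_T(W₁,W₂)|} ≤
  2·2^m·exp(−γ²(|W₁|+|W₂|)/(12L))` when every output owns ≤ 3 legs and all leg-degrees are ≤ L
  (PROOF (4.1): Hoeffding `SfmBl.card_abs_signSum_ge_le` with `Σc_j² ≤ 3e(W₁,W₂) ≤ 3L·min(|W₁|,|W₂|)`).
* `sum_hatE_le` — LEMMA 10 (exchange of sums + the pair bound): for any family `𝒲 ⊇ ⋃_T bad T`,
  `Σ_T ê(T) ≤ 2·2^m · Σ_{W ∈ 𝒲} #{legs meeting W}·exp(−γ²(|W₁|+|W₂|)/(12L))`, and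
  `#{legs meeting W} ≤ L·(|W₁|+|W₂|)` (`card_meeting_le`).  The count of connected pairs by size
  (`|V(S)|·L^{2(k−1)}`, prover-1's `SfmBl.card_connectedThrough_le` / `card_connectedPairs_le`) and the
  numerical series are left to the §6 assembly (`sum_le_sum_by_size` packages the layer-cake step).
-/

namespace Summit.PneNP.PneNP.Theorems.SfmBl

open Matrix Finset BigOperators
open Summit.PneNP.PneNP.Theorems.CandCutNorm

variable {α β E : Type*} [Fintype α] [Fintype β] [Fintype E] [DecidableEq α] [DecidableEq β]

/-! ### `B_S(T)` bookkeeping -/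

omit [Fintype α] [Fintype β] in
/-- GOOD PAIRS OUTSIDE `B` (the hypothesis `hgood` of Prop. 9 for `B = ⋃ bad`): if `bad` contains every
`G`-connected pair with discrepancy `> γ√(|W₁||W₂|)`, then a `G`-connected pair disjoint from
`(⋃_{bad} W₁, ⋃_{bad} W₂)` has discrepancy `≤ γ√(|W₁||W₂|)`. -/
theorem good_of_disjoint_bad (G : SimpleGraph (α ⊕ β)) (N : Matrix α β ℝ) {γ : ℝ}
    (bad : Finset (Finset α × Finset β))
    (hbad : ∀ (W₁ : Finset α) (W₂ : Finset β),
      (G.induce {x | Sum.elim (fun i => i ∈ W₁) (fun j => j ∈ W₂) x}).Connected →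
      γ * Real.sqrt ((W₁.card : ℝ) * (W₂.card : ℝ)) < |∑ i ∈ W₁, ∑ k ∈ W₂, N i k| → (W₁, W₂) ∈ bad)
    (W₁ : Finset α) (W₂ : Finset β)
    (hd₁ : Disjoint W₁ (bad.biUnion Prod.fst)) (hd₂ : Disjoint W₂ (bad.biUnion Prod.snd))
    (hconn : (G.induce {x | Sum.elim (fun i => i ∈ W₁) (fun j => j ∈ W₂) x}).Connected) :
    |∑ i ∈ W₁, ∑ k ∈ W₂, N i k| ≤ γ * Real.sqrt ((W₁.card : ℝ) * (W₂.card : ℝ)) := by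
  by_contra h
  push Not at h
  have hmem := hbad W₁ W₂ hconn h
  have h1 : W₁ = ∅ := Finset.subset_empty.1 fun i hi =>
    (Finset.disjoint_left.1 hd₁ hi (Finset.mem_biUnion.2 ⟨(W₁, W₂), hmem, hi⟩)).elim
  have h2 : W₂ = ∅ := Finset.subset_empty.1 fun k hk =>
    (Finset.disjoint_left.1 hd₂ hk (Finset.mem_biUnion.2 ⟨(W₁, W₂), hmem, hk⟩)).elim
  subst h1; subst h2
  simp at h

omit [Fintype α] [Fintype β] in
/-- `e_B(T) ≤ ê(T)`: the legs meeting `B = (⋃ W₁, ⋃ W₂)` are at most the sum over the bad pairs of the legs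
meeting each pair. -/
theorem card_meeting_bad_le_hatE (src : E → α) (dst : E → β) (bad : Finset (Finset α × Finset β)) :
    (Finset.univ.filter fun e => src e ∈ bad.biUnion Prod.fst ∨ dst e ∈ bad.biUnion Prod.snd).card
      ≤ ∑ W ∈ bad, (Finset.univ.filter fun e => src e ∈ W.1 ∨ dst e ∈ W.2).card := by
  classical
  calc (Finset.univ.filter fun e => src e ∈ bad.biUnion Prod.fst ∨ dst e ∈ bad.biUnion Prod.snd).card
      ≤ (bad.biUnion fun W => Finset.univ.filter fun e => src e ∈ W.1 ∨ dst e ∈ W.2).card := by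
        refine Finset.card_le_card fun e he => ?_
        simp only [Finset.mem_filter, Finset.mem_univ, true_and, Finset.mem_biUnion] at he ⊢
        rcases he with ⟨W, hW, h⟩ | ⟨W, hW, h⟩
        · exact ⟨W, hW, Or.inl h⟩
        · exact ⟨W, hW, Or.inr h⟩
    _ ≤ _ := Finset.card_biUnion_le

/-! ### Degree bookkeeping -/

omit [Fintype α] [Fintype β] in
/-- Legs from `W₁` to `W₂` are at most `L·|W₁|` when every class piece carries ≤ `L` legs. -/
theorem card_pair_le_mul_card_left (src : E → α) (dst : E → β) {L : ℕ}
    (hdeg₁ : ∀ i, (Finset.univ.filter fun e => src e = i).card ≤ L) (W₁ : Finset α) (W₂ : Finset β) :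
    (Finset.univ.filter fun e => src e ∈ W₁ ∧ dst e ∈ W₂).card ≤ L * W₁.card := by
  classical
  calc (Finset.univ.filter fun e => src e ∈ W₁ ∧ dst e ∈ W₂).card
      ≤ (Finset.univ.filter fun e => src e ∈ W₁).card :=
        Finset.card_le_card fun e he => by
          simp only [Finset.mem_filter, Finset.mem_univ, true_and] at he ⊢; exact he.1
    _ = ∑ i ∈ W₁, (Finset.univ.filter fun e => src e = i).card := by
        rw [Finset.card_eq_sum_card_fiberwise (f := src) (t := W₁)
          (s := Finset.univ.filter fun e => src e ∈ W₁) (fun e he =>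
            (Finset.mem_filter.1 (Finset.mem_coe.1 he)).2)]
        refine Finset.sum_congr rfl fun i hi => ?_
        rw [Finset.filter_filter]
        congr 1
        exact Finset.filter_congr fun e _ => ⟨fun h => h.2, fun h => ⟨h ▸ hi, h⟩⟩
    _ ≤ ∑ _i ∈ W₁, L := Finset.sum_le_sum fun i _ => hdeg₁ i
    _ = L * W₁.card := by rw [Finset.sum_const, smul_eq_mul, mul_comm]

omit [Fintype α] [Fintype β] in
/-- Legs from `W₁` to `W₂` are at most `L·|W₂|` when every data piece carries ≤ `L` legs. -/
theorem card_pair_le_mul_card_right (src : E → α) (dst : E → β) {L : ℕ}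
    (hdeg₂ : ∀ k, (Finset.univ.filter fun e => dst e = k).card ≤ L) (W₁ : Finset α) (W₂ : Finset β) :
    (Finset.univ.filter fun e => src e ∈ W₁ ∧ dst e ∈ W₂).card ≤ L * W₂.card := by
  classical
  calc (Finset.univ.filter fun e => src e ∈ W₁ ∧ dst e ∈ W₂).card
      ≤ (Finset.univ.filter fun e => dst e ∈ W₂).card :=
        Finset.card_le_card fun e he => by
          simp only [Finset.mem_filter, Finset.mem_univ, true_and] at he ⊢; exact he.2
    _ = ∑ k ∈ W₂, (Finset.univ.filter fun e => dst e = k).card := by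
        rw [Finset.card_eq_sum_card_fiberwise (f := dst) (t := W₂)
          (s := Finset.univ.filter fun e => dst e ∈ W₂) (fun e he =>
            (Finset.mem_filter.1 (Finset.mem_coe.1 he)).2)]
        refine Finset.sum_congr rfl fun k hk => ?_
        rw [Finset.filter_filter]
        congr 1
        exact Finset.filter_congr fun e _ => ⟨fun h => h.2, fun h => ⟨h ▸ hk, h⟩⟩
    _ ≤ ∑ _k ∈ W₂, L := Finset.sum_le_sum fun k _ => hdeg₂ k
    _ = L * W₂.card := by rw [Finset.sum_const, smul_eq_mul, mul_comm]

/-- Legs MEETING a pair are at most `L·(|W₁| + |W₂|)`. -/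
theorem card_meeting_le (src : E → α) (dst : E → β) {L : ℕ}
    (hdeg₁ : ∀ i, (Finset.univ.filter fun e => src e = i).card ≤ L)
    (hdeg₂ : ∀ k, (Finset.univ.filter fun e => dst e = k).card ≤ L) (W₁ : Finset α) (W₂ : Finset β) :
    (Finset.univ.filter fun e => src e ∈ W₁ ∨ dst e ∈ W₂).card ≤ L * (W₁.card + W₂.card) := by
  classical
  have h1 := card_pair_le_mul_card_left src dst hdeg₁ W₁ (Finset.univ : Finset β)
  have h2 := card_pair_le_mul_card_right src dst hdeg₂ (Finset.univ : Finset α) W₂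
  calc (Finset.univ.filter fun e => src e ∈ W₁ ∨ dst e ∈ W₂).card
      ≤ ((Finset.univ.filter fun e => src e ∈ W₁ ∧ dst e ∈ (Finset.univ : Finset β))
          ∪ (Finset.univ.filter fun e => src e ∈ (Finset.univ : Finset α) ∧ dst e ∈ W₂)).card := by
        refine Finset.card_le_card fun e he => ?_
        simp only [Finset.mem_filter, Finset.mem_univ, true_and, Finset.mem_union, and_true] at he ⊢
        exact he
    _ ≤ (Finset.univ.filter fun e => src e ∈ W₁ ∧ dst e ∈ (Finset.univ : Finset β)).card
          + (Finset.univ.filter fun e => src e ∈ (Finset.univ : Finset α) ∧ dst e ∈ W₂).card :=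
        Finset.card_union_le _ _
    _ ≤ L * W₁.card + L * W₂.card := Nat.add_le_add h1 h2
    _ = L * (W₁.card + W₂.card) := by ring

/-! ### The pair bound (PROOF (4.1)) -/

/-- ANALYTIC CORE of the pair bound: for coefficients `c` with `Σc² ≤ 3La` and `Σc² ≤ 3Lb` (`a, b ≥ 0`,
`L > 0`, `γ ≥ 0`): `#{T : γ√(ab) < |Σ_j c_j χ(T_j)|} ≤ 2·2^m·exp(−γ²(a+b)/(12L))` (Hoeffding + the exponent
comparison `γ²(a+b)/(12L) ≤ γ²ab/(2Σc²)`). -/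
theorem card_abs_signSum_gt_le_of_sq_le {m : ℕ} (c : Fin m → ℝ) {a b L γ : ℝ} (ha : 0 ≤ a) (hb : 0 ≤ b)
    (hL : 0 < L) (hγ : 0 ≤ γ) (h1 : ∑ j, c j ^ 2 ≤ 3 * (L * a)) (h2 : ∑ j, c j ^ 2 ≤ 3 * (L * b)) :
    ((Finset.univ.filter fun T : Fin m → Bool =>
        γ * Real.sqrt (a * b) < |∑ j, c j * ((boolSign (T j) : ℤ) : ℝ)|).card : ℝ)
      ≤ 2 * (2 ^ m * Real.exp (-(γ ^ 2 * (a + b) / (12 * L)))) := by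
  classical
  have hS0 : 0 ≤ ∑ j, c j ^ 2 := Finset.sum_nonneg fun j _ => sq_nonneg _
  have ht0 : 0 ≤ γ * Real.sqrt (a * b) := mul_nonneg hγ (Real.sqrt_nonneg _)
  have hRHS0 : 0 ≤ 2 * (2 ^ m * Real.exp (-(γ ^ 2 * (a + b) / (12 * L)))) := by positivity
  rcases hS0.lt_or_eq with hSpos | hSzero
  · -- Hoeffding
    have hsub : (Finset.univ.filter fun T : Fin m → Bool =>
          γ * Real.sqrt (a * b) < |∑ j, c j * ((boolSign (T j) : ℤ) : ℝ)|)
        ⊆ (Finset.univ.filter fun T : Fin m → Bool =>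
          γ * Real.sqrt (a * b) ≤ |∑ j, c j * ((boolSign (T j) : ℤ) : ℝ)|) := by
      intro T hT
      simp only [Finset.mem_filter, Finset.mem_univ, true_and] at hT ⊢
      exact hT.le
    have hH := card_abs_signSum_ge_le m c ht0 hSpos
    have hexp : Real.exp (-((γ * Real.sqrt (a * b)) ^ 2 / (2 * ∑ j, c j ^ 2)))
        ≤ Real.exp (-(γ ^ 2 * (a + b) / (12 * L))) := by
      rw [Real.exp_le_exp, neg_le_neg_iff]
      have ht2 : (γ * Real.sqrt (a * b)) ^ 2 = γ ^ 2 * (a * b) := by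
        rw [mul_pow, Real.sq_sqrt (mul_nonneg ha hb)]
      rw [ht2, div_le_div_iff₀ (mul_pos (by norm_num) hL) (mul_pos (by norm_num) hSpos)]
      -- `S·(a+b) ≤ 6L·ab`
      have key : (∑ j, c j ^ 2) * (a + b) ≤ 6 * L * (a * b) := by
        have a1 : (∑ j, c j ^ 2) * a ≤ 3 * (L * b) * a := mul_le_mul_of_nonneg_right h2 ha
        have a2 : (∑ j, c j ^ 2) * b ≤ 3 * (L * a) * b := mul_le_mul_of_nonneg_right h1 hb
        calc (∑ j, c j ^ 2) * (a + b) = (∑ j, c j ^ 2) * a + (∑ j, c j ^ 2) * b := by ring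
          _ ≤ 3 * (L * b) * a + 3 * (L * a) * b := add_le_add a1 a2
          _ = 6 * L * (a * b) := by ring
      have key2 := mul_le_mul_of_nonneg_left key (sq_nonneg γ)
      calc γ ^ 2 * (a + b) * (2 * ∑ j, c j ^ 2) = 2 * (γ ^ 2 * ((∑ j, c j ^ 2) * (a + b))) := by ring
        _ ≤ 2 * (γ ^ 2 * (6 * L * (a * b))) := by linarith
        _ = γ ^ 2 * (a * b) * (12 * L) := by ring
    calc ((Finset.univ.filter fun T : Fin m → Bool =>
            γ * Real.sqrt (a * b) < |∑ j, c j * ((boolSign (T j) : ℤ) : ℝ)|).card : ℝ)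
        ≤ ((Finset.univ.filter fun T : Fin m → Bool =>
            γ * Real.sqrt (a * b) ≤ |∑ j, c j * ((boolSign (T j) : ℤ) : ℝ)|).card : ℝ) :=
          Nat.cast_le.2 (Finset.card_le_card hsub)
      _ ≤ 2 * (2 ^ m * Real.exp (-((γ * Real.sqrt (a * b)) ^ 2 / (2 * ∑ j, c j ^ 2)))) := hH
      _ ≤ 2 * (2 ^ m * Real.exp (-(γ ^ 2 * (a + b) / (12 * L)))) :=
          mul_le_mul_of_nonneg_left (mul_le_mul_of_nonneg_left hexp (by positivity)) (by norm_num)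
  · -- all coefficients vanish: the sum is identically zero, no signing qualifies
    have hc0 : ∀ j, c j = 0 := by
      intro j
      have := (Finset.sum_eq_zero_iff_of_nonneg (fun j _ => sq_nonneg (c j))).1 hSzero.symm j
        (Finset.mem_univ j)
      exact pow_eq_zero_iff (n := 2) (by norm_num) |>.1 this
    have hempty : (Finset.univ.filter fun T : Fin m → Bool =>
        γ * Real.sqrt (a * b) < |∑ j, c j * ((boolSign (T j) : ℤ) : ℝ)|) = ∅ := by
      rw [Finset.filter_eq_empty_iff]
      intro T _
      simp only [hc0, zero_mul, Finset.sum_const_zero, abs_zero, not_lt]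
      exact ht0
    rw [hempty, Finset.card_empty, Nat.cast_zero]
    exact hRHS0

/-- BAD SIGNINGS OF ONE PAIR (PROOF (4.1)).  Output-shared signs, ≤ 3 legs per output, leg-degrees ≤ `L`
(`0 < L`), `0 ≤ γ`: `#{T : γ√(|W₁||W₂|) < |disc_T(W₁, W₂)|} ≤ 2·2^m·exp(−γ²(|W₁|+|W₂|)/(12L))`. -/
theorem card_badSignings_pair_le {m : ℕ} (src : E → α) (dst : E → β) (out : E → Fin m)
    (M : (Fin m → Bool) → Matrix α β ℝ)
    (hM : ∀ T i k, M T i k = ∑ e ∈ Finset.univ.filter (fun e => src e = i ∧ dst e = k),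
      ((boolSign (T (out e)) : ℤ) : ℝ))
    (hout : ∀ j : Fin m, (Finset.univ.filter fun e => out e = j).card ≤ 3)
    {L : ℕ} (hL : 0 < L) (hdeg₁ : ∀ i, (Finset.univ.filter fun e => src e = i).card ≤ L)
    (hdeg₂ : ∀ k, (Finset.univ.filter fun e => dst e = k).card ≤ L) {γ : ℝ} (hγ : 0 ≤ γ)
    (W₁ : Finset α) (W₂ : Finset β) :
    ((Finset.univ.filter fun T : Fin m → Bool =>
        γ * Real.sqrt ((W₁.card : ℝ) * (W₂.card : ℝ)) < |∑ i ∈ W₁, ∑ k ∈ W₂, M T i k|).card : ℝ)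
      ≤ 2 * (2 ^ m * Real.exp (-(γ ^ 2 * ((W₁.card : ℝ) + W₂.card) / (12 * L)))) := by
  classical
  -- rewrite the discrepancy as the signed sum of the leg counts
  have hdisc : ∀ T : Fin m → Bool, ∑ i ∈ W₁, ∑ k ∈ W₂, M T i k
      = ∑ j, ((Finset.univ.filter fun e => out e = j ∧ src e ∈ W₁ ∧ dst e ∈ W₂).card : ℝ)
          * ((boolSign (T j) : ℤ) : ℝ) := fun T =>
    pairSum_eq_sum_outputs src dst out T (M T) (hM T) W₁ W₂
  have hfilt : (Finset.univ.filter fun T : Fin m → Bool =>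
        γ * Real.sqrt ((W₁.card : ℝ) * (W₂.card : ℝ)) < |∑ i ∈ W₁, ∑ k ∈ W₂, M T i k|)
      = (Finset.univ.filter fun T : Fin m → Bool =>
        γ * Real.sqrt ((W₁.card : ℝ) * (W₂.card : ℝ))
          < |∑ j, ((Finset.univ.filter fun e => out e = j ∧ src e ∈ W₁ ∧ dst e ∈ W₂).card : ℝ)
              * ((boolSign (T j) : ℤ) : ℝ)|) :=
    Finset.filter_congr fun T _ => by rw [hdisc T]
  rw [hfilt]
  -- the two variance bounds `Σc² ≤ 3e(W₁,W₂) ≤ 3L|W₁|, 3L|W₂|`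
  have hSle := sum_legCount_sq_le src dst out hout W₁ W₂
  have he1 : ((Finset.univ.filter fun e => src e ∈ W₁ ∧ dst e ∈ W₂).card : ℝ) ≤ L * (W₁.card : ℝ) := by
    exact_mod_cast card_pair_le_mul_card_left src dst hdeg₁ W₁ W₂
  have he2 : ((Finset.univ.filter fun e => src e ∈ W₁ ∧ dst e ∈ W₂).card : ℝ) ≤ L * (W₂.card : ℝ) := by
    exact_mod_cast card_pair_le_mul_card_right src dst hdeg₂ W₁ W₂
  have hL' : (0 : ℝ) < L := by exact_mod_cast hL
  exact card_abs_signSum_gt_le_of_sq_le _ (Nat.cast_nonneg _) (Nat.cast_nonneg _) hL' hγ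
    (hSle.trans (by linarith)) (hSle.trans (by linarith))

/-! ### Lemma 10: exchange of sums -/

/-- LEMMA 10 (first moment of `ê`).  `bad T ⊆ 𝒲` for all `T`, and membership in `bad T` implies
`γ√(|W₁||W₂|) < |disc_T|`; then `Σ_T ê(T) ≤ 2·2^m · Σ_{W ∈ 𝒲} #{legs meeting W}·e^{−γ²(|W₁|+|W₂|)/(12L)}`. -/
theorem sum_hatE_le {m : ℕ} (src : E → α) (dst : E → β) (out : E → Fin m)
    (M : (Fin m → Bool) → Matrix α β ℝ)
    (hM : ∀ T i k, M T i k = ∑ e ∈ Finset.univ.filter (fun e => src e = i ∧ dst e = k),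
      ((boolSign (T (out e)) : ℤ) : ℝ))
    (hout : ∀ j : Fin m, (Finset.univ.filter fun e => out e = j).card ≤ 3)
    {L : ℕ} (hL : 0 < L) (hdeg₁ : ∀ i, (Finset.univ.filter fun e => src e = i).card ≤ L)
    (hdeg₂ : ∀ k, (Finset.univ.filter fun e => dst e = k).card ≤ L) {γ : ℝ} (hγ : 0 ≤ γ)
    (bad : (Fin m → Bool) → Finset (Finset α × Finset β)) (𝒲 : Finset (Finset α × Finset β))
    (hsub : ∀ T, bad T ⊆ 𝒲)
    (hbad : ∀ T W, W ∈ bad T →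
      γ * Real.sqrt ((W.1.card : ℝ) * (W.2.card : ℝ)) < |∑ i ∈ W.1, ∑ k ∈ W.2, M T i k|) :
    ∑ T : Fin m → Bool, ∑ W ∈ bad T, ((Finset.univ.filter fun e => src e ∈ W.1 ∨ dst e ∈ W.2).card : ℝ)
      ≤ 2 * 2 ^ m * ∑ W ∈ 𝒲, ((Finset.univ.filter fun e => src e ∈ W.1 ∨ dst e ∈ W.2).card : ℝ)
          * Real.exp (-(γ ^ 2 * ((W.1.card : ℝ) + W.2.card) / (12 * L))) := by
  classical
  -- write the inner sum over `𝒲` with an indicator, then exchange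
  have h1 : ∀ T, ∑ W ∈ bad T, ((Finset.univ.filter fun e => src e ∈ W.1 ∨ dst e ∈ W.2).card : ℝ)
      = ∑ W ∈ 𝒲, (if W ∈ bad T then
          ((Finset.univ.filter fun e => src e ∈ W.1 ∨ dst e ∈ W.2).card : ℝ) else 0) := by
    intro T
    rw [← Finset.sum_filter]
    congr 1
    ext W; simp only [Finset.mem_filter]
    exact ⟨fun h => ⟨hsub T h, h⟩, fun h => h.2⟩
  simp_rw [h1]
  rw [Finset.sum_comm, Finset.mul_sum]
  refine Finset.sum_le_sum fun W _ => ?_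
  -- per pair: `meet(W) · #{T : W ∈ bad T} ≤ meet(W) · #{T : bad inequality} ≤ meet(W) · 2·2^m·e^{…}`
  have hmeet0 : (0 : ℝ) ≤ ((Finset.univ.filter fun e => src e ∈ W.1 ∨ dst e ∈ W.2).card : ℝ) := by
    positivity
  have h2 : ∑ T : Fin m → Bool, (if W ∈ bad T then
        ((Finset.univ.filter fun e => src e ∈ W.1 ∨ dst e ∈ W.2).card : ℝ) else 0)
      = ((Finset.univ.filter fun e => src e ∈ W.1 ∨ dst e ∈ W.2).card : ℝ)
          * ((Finset.univ.filter fun T : Fin m → Bool => W ∈ bad T).card : ℝ) := by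
    rw [← Finset.sum_filter, Finset.sum_const, nsmul_eq_mul, mul_comm]
  rw [h2]
  have hsubT : (Finset.univ.filter fun T : Fin m → Bool => W ∈ bad T)
      ⊆ (Finset.univ.filter fun T : Fin m → Bool =>
          γ * Real.sqrt ((W.1.card : ℝ) * (W.2.card : ℝ)) < |∑ i ∈ W.1, ∑ k ∈ W.2, M T i k|) := by
    intro T hT
    simp only [Finset.mem_filter, Finset.mem_univ, true_and] at hT ⊢
    exact hbad T W hT
  have h3 : ((Finset.univ.filter fun T : Fin m → Bool => W ∈ bad T).card : ℝ)
      ≤ ((Finset.univ.filter fun T : Fin m → Bool =>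
          γ * Real.sqrt ((W.1.card : ℝ) * (W.2.card : ℝ)) < |∑ i ∈ W.1, ∑ k ∈ W.2, M T i k|).card : ℝ) :=
    Nat.cast_le.2 (Finset.card_le_card hsubT)
  have h4 := card_badSignings_pair_le src dst out M hM hout hL hdeg₁ hdeg₂ hγ W.1 W.2
  calc ((Finset.univ.filter fun e => src e ∈ W.1 ∨ dst e ∈ W.2).card : ℝ)
        * ((Finset.univ.filter fun T : Fin m → Bool => W ∈ bad T).card : ℝ)
      ≤ ((Finset.univ.filter fun e => src e ∈ W.1 ∨ dst e ∈ W.2).card : ℝ)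
        * (2 * (2 ^ m * Real.exp (-(γ ^ 2 * ((W.1.card : ℝ) + W.2.card) / (12 * L))))) :=
        mul_le_mul_of_nonneg_left (h3.trans h4) hmeet0
    _ = 2 * 2 ^ m * (((Finset.univ.filter fun e => src e ∈ W.1 ∨ dst e ∈ W.2).card : ℝ)
        * Real.exp (-(γ ^ 2 * ((W.1.card : ℝ) + W.2.card) / (12 * L)))) := by ring

omit [DecidableEq α] [DecidableEq β] in
/-- LAYER-CAKE BY SIZE (packaging for the §6 numerics): if the pairs of `𝒲` of total size `k` number at most
`Nk k` and `f` is a nonnegative weight depending only on the size, then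
`Σ_{W ∈ 𝒲} f(|W₁|+|W₂|) ≤ Σ_{k ≤ |α|+|β|} Nk k · f k`. -/
theorem sum_le_sum_by_size (𝒲 : Finset (Finset α × Finset β)) (f : ℕ → ℝ) (hf : ∀ k, 0 ≤ f k)
    (Nk : ℕ → ℝ) (hNk : ∀ k, ((𝒲.filter fun W => W.1.card + W.2.card = k).card : ℝ) ≤ Nk k) :
    ∑ W ∈ 𝒲, f (W.1.card + W.2.card)
      ≤ ∑ k ∈ Finset.range (Fintype.card α + Fintype.card β + 1), Nk k * f k := by
  classical
  have hmaps : ∀ W ∈ 𝒲, W.1.card + W.2.card ∈ Finset.range (Fintype.card α + Fintype.card β + 1) := by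
    intro W _
    rw [Finset.mem_range]
    have h1 : W.1.card ≤ Fintype.card α := Finset.card_le_univ _
    have h2 : W.2.card ≤ Fintype.card β := Finset.card_le_univ _
    omega
  rw [← Finset.sum_fiberwise_of_maps_to hmaps]
  refine Finset.sum_le_sum fun k _ => ?_
  have : ∑ W ∈ 𝒲.filter (fun W => W.1.card + W.2.card = k), f (W.1.card + W.2.card)
      = ((𝒲.filter fun W => W.1.card + W.2.card = k).card : ℝ) * f k := by
    rw [Finset.sum_congr rfl (fun W hW => by
      simp only [Finset.mem_filter] at hW; rw [hW.2]), Finset.sum_const, nsmul_eq_mul]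
  rw [this]
  exact mul_le_mul_of_nonneg_right (hNk k) (hf k)

end Summit.PneNP.PneNP.Theorems.SfmBl
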